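import Summits.CriticalPhenomena.CardyFormulaZ2.Theses.CardyMagicRigidity
import Literature.Probability.Percolation.FullPlaneCNL
import Literature.Probability.Percolation.LoopRepresentationProofs
import Literature.Probability.RandomPlanarGeometry.LocFinLoopConfig
import Summits.CriticalPhenomena.CardyFormulaZ2.Theorems.CardyMagicRigidityNestingRigidityTransferGluing

/-!
# `LoopLimitZ2EqT` (stmt-CriticalPhenomena-4833), negative side I: separating events and
# the falsifiable content of `X`

Negative-side support for the crux `CardyMagicRigidity.LoopLimitZ2EqT` =: `X` (cdisprove unit
refuter-cdisprove-stmt-CriticalPhenomena-4833-0, cycle 1; work file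
`Cruxes/LoopLimitZ2EqT/Disproof.lean`, which also holds the positive-direction reduction
`loopLimit_of_tendsto_bond` that cannot live here). `X` says
`d_CN((P^bond_{1/2}, bondLoopConfig δ 0), (P^site_{1/2}, siteLoopConfig δ)) → 0` as `δ → 0⁺`
(DKKMO's coupling distance, arXiv:2012.11672v2 eq. (2)). The crux is NOT refuted: it is the full-plane
CLE₆ universality conjecture for bond percolation on `ℤ²` (Disproof.lean §1). This file records,
sorry-free and definition-free:

* `measurableSet_isClose_site_bond` (the `bond × site` order is the tree's
  `RingCloudTomography.measurableSet_isClose_bondLoopConfig_siteLoopConfig`, file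
  `CardyMagicRigidityNestingRigidityTransferGluing.lean`, which also holds the common-limit transfer
  `tendsto_cnLawEDist_bond_site_of_tendsto`) — the exceptional event of `d_CN` between the two lattice
  ensembles is measurable (countable generation), so couplings measure genuine events and can be glued
  through either lattice; `measurableSet_exists_mem_of_gen` /
  `measurableSet_forall_mem_of_gen` and their bond / site instances — loop events ("some / every member
  of type `i` has property `P`") are measurable;
* `ofReal_le_cnLawEDist_of_separating` — **Strassen-type lower bound**: measurable events `A`, `B` of
  the two laws on which `IsClose ε` fails pairwise and with `μ A + μ' B ≥ 1 + ε` force `d_CN ≥ ε`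
  (inclusion–exclusion inside any coupling); `mass_lt_of_cnLawEDist_lt` is the contrapositive;
* `not_loopLimitZ2EqT_of_frequently_separated` — the refutation criterion for `X` this yields, and
  `loopLimitZ2EqT_eventually_mass_lt` — its positive dual (the quantitative content of `X`);
* `not_isClose_of_unmatched_big_loop` — the geometric separation available in `d_CN`: a type-`i`
  loop inside `B(0,r)`, `r ≤ 1/ε`, of trace-diameter `≥ D` is `ε`-far from every configuration
  without a type-`i` loop inside `B(0, r+ε)` of diameter `≥ D − 2ε`; hence
  `loopLimitZ2EqT_bigLoop_mass_lt` — under `X` the largest-loop distribution functions of the two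
  lattices agree up to `ε`-shifts (the Monte-Carlo-falsifiable prediction; cf. the hull statistics
  of Cardy–Ziff, J. Stat. Phys. 110 (2003), §3.1/§3.3, measured on bond-□ and site-△ with the same
  typed hull walks: `2A·N(A,2A) → 0.0229712` resp. `0.022977` against `1/(8√3 π) = 0.0229720`);
(Companion file `CriticalityLoadBearing.lean`: what `X` transfers — `tendsto_bond_of_loopLimit`,
`cnLawEDist_bond_bond_le`, `loopLimitZ2EqT_bond_cauchy` — and `not_tendsto_offCritical_of`, criticality on the
`ℤ²` side is load-bearing.)
-/

noncomputable section

namespace Summit.CriticalPhenomena.CardyFormulaZ2.Theorems.LoopLimitZ2EqT.Negative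

open Filter Set MeasureTheory
open scoped Topology ENNReal
open Literature.Probability.Percolation Literature.Probability.LatticeModels
  Literature.Probability.RandomPlanarGeometry
open Summit.CriticalPhenomena.CardyFormulaZ2.Theses.CardyMagicRigidity (LoopLimitZ2EqT)

/-! ## Measurability of the exceptional events -/

/-- The crux unfolded (the inline site configuration of the route file is the tree's
`siteLoopConfig`, `siteLoopConfig_eq`). [folklore] -/
theorem loopLimitZ2EqT_iff : LoopLimitZ2EqT ↔ Tendsto (fun δ : ℝ ↦
    LoopConfig.cnLawEDist (bondPercolation (zdGraph 2) half) (bondLoopConfig δ 0)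
      (triSitePercolation half) (siteLoopConfig δ)) (𝓝[>] 0) (𝓝 0) := Iff.rfl

/-- Measurability of the exceptional event `{d_CN(site_δ', bond_δ^α) ≤ ε}` on pairs of lattice
configurations (the `bond × site` order is the tree's
`RingCloudTomography.measurableSet_isClose_bondLoopConfig_siteLoopConfig`; both loop representations are
countably generated by measurable "`γ` is an interface loop of type `i`" events). [folklore] -/
theorem measurableSet_isClose_site_bond (δ' δ α ε : ℝ) :
    MeasurableSet {p : SiteConfig (Site 2) × BondConfig (Site 2) |
      LoopConfig.IsClose ε (siteLoopConfig δ' p.1) (bondLoopConfig δ α p.2)} := by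
  haveI := countable_sigma_hexLoop
  exact LoopConfig.measurableSet_isClose_of_gen
    (measurableSet_gen_siteLoopConfig) (gen_siteLoopConfig δ')
    (fun i (k : {γ : List MedialVertex // γ ≠ []}) ↦ measurableSet_setOf_isInterfaceLoop_and k.1 i)
    (gen_bondLoopConfig δ α) ε

/-! ### Loop events are measurable -/

section LoopEvents

variable {E : Type*} [NormedAddCommGroup E] {Ω : Type*} [MeasurableSpace Ω]

/-- For a countably generated random configuration (`LoopConfig.isClose_iff_of_gen` format), the event
"some member of type `i` has property `P`" is measurable: it is the countable union of the generating
events over the indices whose loop has `P`. [folklore] -/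
theorem measurableSet_exists_mem_of_gen {ι : Type*} [Countable ι] {X : Ω → LoopConfig E}
    {f : Fin 2 → ι → UnbasedLoop E} {S : Fin 2 → ι → Set Ω} (hS : ∀ i k, MeasurableSet (S i k))
    (hX : ∀ ω i u, u ∈ (X ω).F i ↔ ∃ k, ω ∈ S i k ∧ f i k = u) (i : Fin 2)
    (P : UnbasedLoop E → Prop) : MeasurableSet {ω | ∃ u ∈ (X ω).F i, P u} := by
  have e : {ω | ∃ u ∈ (X ω).F i, P u} = ⋃ k ∈ {k : ι | P (f i k)}, S i k := by
    ext ω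
    simp only [Set.mem_setOf_eq, Set.mem_iUnion, exists_prop]
    constructor
    · rintro ⟨u, hu, hP⟩
      obtain ⟨k, hk, rfl⟩ := (hX ω i u).1 hu
      exact ⟨k, hP, hk⟩
    · rintro ⟨k, hP, hk⟩
      exact ⟨f i k, (hX ω i _).2 ⟨k, hk, rfl⟩, hP⟩
  rw [e]
  exact MeasurableSet.biUnion (Set.to_countable _) fun k _ ↦ hS i k

/-- Dually, "every member of type `i` has property `P`" is measurable. [folklore] -/
theorem measurableSet_forall_mem_of_gen {ι : Type*} [Countable ι] {X : Ω → LoopConfig E}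
    {f : Fin 2 → ι → UnbasedLoop E} {S : Fin 2 → ι → Set Ω} (hS : ∀ i k, MeasurableSet (S i k))
    (hX : ∀ ω i u, u ∈ (X ω).F i ↔ ∃ k, ω ∈ S i k ∧ f i k = u) (i : Fin 2)
    (P : UnbasedLoop E → Prop) : MeasurableSet {ω | ∀ u ∈ (X ω).F i, P u} := by
  have e : {ω | ∀ u ∈ (X ω).F i, P u} = {ω | ∃ u ∈ (X ω).F i, ¬ P u}ᶜ := by
    ext ω; simp
  rw [e]
  exact (measurableSet_exists_mem_of_gen hS hX i (fun u ↦ ¬ P u)).compl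

end LoopEvents

/-- Loop events of the bond ensemble are measurable (`∃` form). [folklore] -/
theorem measurableSet_exists_mem_bondLoopConfig (δ α : ℝ) (i : Fin 2) (P : UnbasedLoop ℂ → Prop) :
    MeasurableSet {ω : BondConfig (Site 2) | ∃ u ∈ (bondLoopConfig δ α ω).F i, P u} :=
  measurableSet_exists_mem_of_gen
    (fun i (k : {γ : List MedialVertex // γ ≠ []}) ↦ measurableSet_setOf_isInterfaceLoop_and k.1 i)
    (gen_bondLoopConfig δ α) i P

/-- Loop events of the bond ensemble are measurable (`∀` form). [folklore] -/
theorem measurableSet_forall_mem_bondLoopConfig (δ α : ℝ) (i : Fin 2) (P : UnbasedLoop ℂ → Prop) :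
    MeasurableSet {ω : BondConfig (Site 2) | ∀ u ∈ (bondLoopConfig δ α ω).F i, P u} :=
  measurableSet_forall_mem_of_gen
    (fun i (k : {γ : List MedialVertex // γ ≠ []}) ↦ measurableSet_setOf_isInterfaceLoop_and k.1 i)
    (gen_bondLoopConfig δ α) i P

/-- Loop events of the site ensemble are measurable (`∃` form). [folklore] -/
theorem measurableSet_exists_mem_siteLoopConfig (δ : ℝ) (i : Fin 2) (P : UnbasedLoop ℂ → Prop) :
    MeasurableSet {ω : SiteConfig (Site 2) | ∃ u ∈ (siteLoopConfig δ ω).F i, P u} := by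
  haveI := countable_sigma_hexLoop
  exact measurableSet_exists_mem_of_gen (measurableSet_gen_siteLoopConfig) (gen_siteLoopConfig δ) i P

/-- Loop events of the site ensemble are measurable (`∀` form). [folklore] -/
theorem measurableSet_forall_mem_siteLoopConfig (δ : ℝ) (i : Fin 2) (P : UnbasedLoop ℂ → Prop) :
    MeasurableSet {ω : SiteConfig (Site 2) | ∀ u ∈ (siteLoopConfig δ ω).F i, P u} := by
  haveI := countable_sigma_hexLoop
  exact measurableSet_forall_mem_of_gen (measurableSet_gen_siteLoopConfig) (gen_siteLoopConfig δ) i P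

/-! ## Separating events: the Strassen-type lower bound and the refutation criterion -/

section Template

variable {E : Type*} [NormedAddCommGroup E]
variable {Ω Ω' : Type*} [MeasurableSpace Ω] [MeasurableSpace Ω']

/-- **Strassen-type lower bound for DKKMO's coupling distance.** If measurable events `A` (first law)
and `B` (second law) are `ε`-separated — `IsClose ε` fails for every pair in `A × B` — and carry total
mass `μ A + μ' B ≥ 1 + ε`, then `d_CN ≥ ε`: under any coupling `P`, `P(A × B) ≥ μ A + μ' B − 1 ≥ ε`
(inclusion–exclusion), and `A × B` lies in the exceptional event. This is the only mechanism by which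
`X` can be refuted. (Dudley, *Real Analysis and Probability*, §11.6; Strassen 1965.) [folklore] -/
theorem ofReal_le_cnLawEDist_of_separating {μ : Measure Ω} {μ' : Measure Ω'}
    [IsProbabilityMeasure μ] [IsProbabilityMeasure μ'] {X : Ω → LoopConfig E} {X' : Ω' → LoopConfig E}
    {ε : ℝ} {A : Set Ω} {B : Set Ω'} (hA : MeasurableSet A) (hB : MeasurableSet B)
    (hsep : ∀ a ∈ A, ∀ b ∈ B, ¬ LoopConfig.IsClose ε (X a) (X' b))
    (hmass : 1 + ENNReal.ofReal ε ≤ μ A + μ' B) :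
    ENNReal.ofReal ε ≤ LoopConfig.cnLawEDist μ X μ' X' := by
  by_contra h
  push Not at h
  obtain ⟨P, h₁, h₂, hP⟩ := LoopConfig.exists_coupling_of_cnLawEDist_lt h
  have hPuniv : P univ = 1 := by
    rw [← preimage_univ (f := (Prod.fst : Ω × Ω' → Ω)),
      ← Measure.map_apply measurable_fst MeasurableSet.univ, h₁, measure_univ]
  have hPA : P (A ×ˢ (univ : Set Ω')) = μ A := by
    rw [prod_univ, ← Measure.map_apply measurable_fst hA, h₁]
  have hPB : P ((univ : Set Ω) ×ˢ B) = μ' B := by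
    rw [univ_prod, ← Measure.map_apply measurable_snd hB, h₂]
  have hIE := measure_union_add_inter (μ := P) (A ×ˢ (univ : Set Ω')) (MeasurableSet.univ.prod hB)
  have hinter : A ×ˢ (univ : Set Ω') ∩ (univ : Set Ω) ×ˢ B = A ×ˢ B := by
    rw [prod_inter_prod, inter_univ, univ_inter]
  rw [hinter, hPA, hPB] at hIE
  have hunion : P (A ×ˢ (univ : Set Ω') ∪ (univ : Set Ω) ×ˢ B) ≤ 1 :=
    hPuniv ▸ measure_mono (subset_univ _)
  have hAB : ENNReal.ofReal ε ≤ P (A ×ˢ B) := by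
    have key : 1 + ENNReal.ofReal ε ≤ 1 + P (A ×ˢ B) :=
      calc 1 + ENNReal.ofReal ε ≤ μ A + μ' B := hmass
        _ = P (A ×ˢ (univ : Set Ω') ∪ (univ : Set Ω) ×ˢ B) + P (A ×ˢ B) := hIE.symm
        _ ≤ 1 + P (A ×ˢ B) := by gcongr
    exact (ENNReal.add_le_add_iff_left ENNReal.one_ne_top).1 key
  have hsub : A ×ˢ B ⊆ {p : Ω × Ω' | ¬ LoopConfig.IsClose ε (X p.1) (X' p.2)} := by
    rintro ⟨a, b⟩ ⟨ha, hb⟩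
    exact hsep a ha b hb
  exact lt_irrefl _ ((hAB.trans (measure_mono hsub)).trans_lt hP)

/-- The positive reading (quantitative transfer): if `d_CN < ε` then every `ε`-separated pair of
measurable events has total mass `< 1 + ε`. [folklore] -/
theorem mass_lt_of_cnLawEDist_lt {μ : Measure Ω} {μ' : Measure Ω'}
    [IsProbabilityMeasure μ] [IsProbabilityMeasure μ'] {X : Ω → LoopConfig E} {X' : Ω' → LoopConfig E}
    {ε : ℝ} (h : LoopConfig.cnLawEDist μ X μ' X' < ENNReal.ofReal ε) {A : Set Ω} {B : Set Ω'}
    (hA : MeasurableSet A) (hB : MeasurableSet B)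
    (hsep : ∀ a ∈ A, ∀ b ∈ B, ¬ LoopConfig.IsClose ε (X a) (X' b)) :
    μ A + μ' B < 1 + ENNReal.ofReal ε := by
  by_contra hle
  push Not at hle
  exact (not_le.2 h) (ofReal_le_cnLawEDist_of_separating hA hB hsep hle)

end Template

/-- **Refutation criterion for `X`.** `X` fails as soon as, for one `ε > 0` and meshes `δ → 0⁺`
(frequently), there are measurable `ε`-separated events of total mass `≥ 1 + ε`. [folklore] -/
theorem not_loopLimitZ2EqT_of_frequently_separated {ε : ℝ} (hε : 0 < ε)
    (h : ∃ᶠ δ in 𝓝[>] (0 : ℝ), ∃ (A : Set (BondConfig (Site 2))) (B : Set (SiteConfig (Site 2))),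
      MeasurableSet A ∧ MeasurableSet B ∧
        (∀ a ∈ A, ∀ b ∈ B, ¬ LoopConfig.IsClose ε (bondLoopConfig δ 0 a) (siteLoopConfig δ b)) ∧
          1 + ENNReal.ofReal ε ≤ (bondPercolation (zdGraph 2) half) A + (triSitePercolation half) B) :
    ¬ LoopLimitZ2EqT := by
  intro hX
  rw [loopLimitZ2EqT_iff] at hX
  have hlt : ∀ᶠ δ in 𝓝[>] (0 : ℝ), (LoopConfig.cnLawEDist (bondPercolation (zdGraph 2) half) (bondLoopConfig δ 0)
      (triSitePercolation half) (siteLoopConfig δ)) < ENNReal.ofReal ε :=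
    hX (Iio_mem_nhds (ENNReal.ofReal_pos.2 hε))
  refine (h.and_eventually hlt).exists.elim fun δ hδ ↦ ?_
  obtain ⟨⟨A, B, hA, hB, hsep, hmass⟩, hd⟩ := hδ
  exact (not_le.2 hd) (ofReal_le_cnLawEDist_of_separating hA hB hsep hmass)

/-- **The falsifiable content of `X`**: under `X`, for every `ε > 0` and all small `δ > 0`, every pair of
measurable `ε`-separated loop events has total mass `< 1 + ε`. [folklore] -/
theorem loopLimitZ2EqT_eventually_mass_lt (hX : LoopLimitZ2EqT) {ε : ℝ} (hε : 0 < ε) :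
    ∀ᶠ δ in 𝓝[>] (0 : ℝ), ∀ (A : Set (BondConfig (Site 2))) (B : Set (SiteConfig (Site 2))),
      MeasurableSet A → MeasurableSet B →
        (∀ a ∈ A, ∀ b ∈ B, ¬ LoopConfig.IsClose ε (bondLoopConfig δ 0 a) (siteLoopConfig δ b)) →
          (bondPercolation (zdGraph 2) half) A + (triSitePercolation half) B < 1 + ENNReal.ofReal ε := by
  rw [loopLimitZ2EqT_iff] at hX
  have hlt : ∀ᶠ δ in 𝓝[>] (0 : ℝ), (LoopConfig.cnLawEDist (bondPercolation (zdGraph 2) half) (bondLoopConfig δ 0)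
      (triSitePercolation half) (siteLoopConfig δ)) < ENNReal.ofReal ε :=
    hX (Iio_mem_nhds (ENNReal.ofReal_pos.2 hε))
  filter_upwards [hlt] with δ hδ A B hA hB hsep
  exact mass_lt_of_cnLawEDist_lt hδ hA hB hsep

/-! ### The geometric separation that is actually available: unmatched big loops -/

section Geometry

variable {E : Type*} [NormedAddCommGroup E]

/-- **Unmatched big loops separate.** If `c` has a type-`i` loop inside `B(0, r)` (with
`r ≤ 1/ε`, so that it lies in the window) whose trace has diameter `≥ D`, while `c'` has NO type-`i`
loop inside `B(0, r + ε)` of trace-diameter `≥ D − 2ε`, then `¬ IsClose ε c c'`: a partner `u'` with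
`udist u u' ≤ ε` would lie in `B(0, r + ε)` (`range_subset_ball_of_udist_le`) and have
`diam u' ≥ diam u − 2ε` (`diam_range_le_of_udist_le`). This is the `d_CN`-robust form of "there is a
macroscopic loop" — the only kind of loop event the coupling distance sees. [folklore] -/
theorem not_isClose_of_unmatched_big_loop {ε r D : ℝ} {c c' : LoopConfig E} {i : Fin 2}
    (hr : r ≤ 1 / ε) {u : UnbasedLoop E} (hu : u ∈ c.F i) (hur : u.range ⊆ Metric.ball 0 r)
    (huD : D ≤ Metric.diam u.range)
    (hno : ∀ u' ∈ c'.F i, u'.range ⊆ Metric.ball 0 (r + ε) → Metric.diam u'.range < D - 2 * ε) :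
    ¬ LoopConfig.IsClose ε c c' := by
  intro hc
  obtain ⟨u', hu', hd⟩ := (hc i).1 u hu (hur.trans (Metric.ball_subset_ball hr))
  have h1 : u'.range ⊆ Metric.ball 0 (r + ε) := UnbasedLoop.range_subset_ball_of_udist_le hur hd
  have h2 : Metric.diam u.range ≤ Metric.diam u'.range + 2 * ε :=
    UnbasedLoop.diam_range_le_of_udist_le u u' hd
  have h3 := hno u' hu' h1
  linarith

end Geometry

/-- **`X` ⇒ largest-loop distribution functions agree up to `ε`-shifts** (the Monte-Carlo-testable
prediction). For `0 < ε`, `r ≤ 1/ε` and any `D`, under `X`, for all small `δ > 0`: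
`P^bond[∃ type-i loop ⊂ B_r with diam ≥ D] + P^site[no type-i loop ⊂ B_{r+ε} with diam ≥ D − 2ε] < 1 + ε`,
i.e. `P^bond[big loop] ≤ P^site[slightly smaller loop in slightly bigger ball] + ε` (and symmetrically).
The two events are measurable (`measurableSet_exists_mem_bondLoopConfig`,
`measurableSet_forall_mem_siteLoopConfig`), so there is no side condition. [folklore] -/
theorem loopLimitZ2EqT_bigLoop_mass_lt (hX : LoopLimitZ2EqT) {ε r D : ℝ} (hε : 0 < ε)
    (hr : r ≤ 1 / ε) (i : Fin 2) :
    ∀ᶠ δ in 𝓝[>] (0 : ℝ),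
      (bondPercolation (zdGraph 2) half) {ω | ∃ u ∈ (bondLoopConfig δ 0 ω).F i, u.range ⊆ Metric.ball 0 r ∧ D ≤ Metric.diam u.range} +
        (triSitePercolation half) {ω | ∀ u' ∈ (siteLoopConfig δ ω).F i,
          u'.range ⊆ Metric.ball 0 (r + ε) → Metric.diam u'.range < D - 2 * ε} <
        1 + ENNReal.ofReal ε := by
  filter_upwards [loopLimitZ2EqT_eventually_mass_lt hX hε] with δ hδ
  refine hδ _ _ (measurableSet_exists_mem_bondLoopConfig δ 0 i _)
    (measurableSet_forall_mem_siteLoopConfig δ i _) fun a ha b hb ↦ ?_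
  obtain ⟨u, hu, hur, huD⟩ := ha
  exact not_isClose_of_unmatched_big_loop hr hu hur huD hb

end Summit.CriticalPhenomena.CardyFormulaZ2.Theorems.LoopLimitZ2EqT.Negative

end
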